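import Mathlib
import HarnessLib
import Summits.HubbardSuperconductivity.HubbardSuperconductivity.Theses.FunctionFieldCertificate
import Summits.HubbardSuperconductivity.HubbardSuperconductivity.Theorems.FunctionFieldCertificateWindowInfraredBoundGoldstoneOfPgd

/-!
# `MesoscopicPairOrder` (stmt-HubbardSuperconductivity-7331), line `redirect_birth`, stub (GS-box)
# `stub_pairGoldstoneShapeOnBox`: the POINTWISE (GD) ∧ (Ch) ⇒ (GS) glue

Support file for the crux (route `FunctionFieldCertificate`, pole-free half; line `redirect_birth`, lead c11,
wave 3, stub worker of (GS-box)). The registered stub (GS-box) `stub_pairGoldstoneShapeOnBox` asks the WINDOW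
GOLDSTONE SHAPE `S_ψ(m)·|q_m| ≤ A` on `0 < |q_m| ≤ ε₀` of every normalised `(N_L, 0)`-sector ground state of
`hubbardTorus 2 L 1 U`, eventually in even `L`, at every `(U, δ)` of the BOX `U ∈ (0,6]`, `δ ∈ [1/10,3/10]`.
Its one engine in the tree, `WindowInfraredBound.goldstoneShape_of_pairGaussianDomination_of_chargingFloor`
(`…WindowInfraredBoundGoldstoneOfPgd.lean`, crux stmt-HubbardSuperconductivity-1089), is stated
`∀ (U,δ) ⇒ ∀ (U,δ)`: it consumes the two OPEN physics stubs of the stmt-1089 energy-form line — (GD) = C⁺_λ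
`WindowInfraredBound.stub_pairGaussianDomination` (one-sided, own-bottom, `λ_q`-regularised ground-energy Gaussian
domination in the `d`-wave pair channel) and (Ch) `WindowInfraredBound.stub_chargingFloor` (`pairGap ≥ −κ/L`) — at
ALL `U > 0`, `δ ∈ (0,1/2)`. So BOX-RESTRICTED versions of (GD), (Ch) — the only versions the reshaped line needs,
and the only ones not exposed to strong-coupling stripes / phase separation outside the box — do not feed the
box-restricted stub through it. The engine's PROOF is pointwise in `(U, δ)` (it ends in the one-state closure
`WindowInfraredBound.goldstoneShape_of_regularisedClosure`); this file records that as theorems: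

* `goldstoneShapeAt_of_pgdAt_of_chargingFloorAt` — at ONE point `U > 0`, `δ ∈ (0,1/2)`: the body of (GD) at
  `(U,δ)` and the body of (Ch) at `(U,δ)` imply the body of (GS) at `(U,δ)`, with the engine's constants
  `ε₀ = η`, `A = 2√((C₁ + C₃C₂)C_χ) + 2κC_χ/π + 2c₀C_χη` (landed budgets F1 `stub_doubleCommBound` — the one place
  `U > 0` is used —, F2 `WcbcsSsbToTorusLRO.stub_pairCommutatorBudget`, F3 `wib_twoParticleCost_holds`; landed first
  variation `WindowInfraredBound.stub_pgdFirstVariation`, p96685; landed regularised Pitaevskii–Stringari closure,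
  p96461, inside `goldstoneShape_of_regularisedClosure`).
* `goldstoneShapeAtOfPgdAtOfChargingFloorAt` — its registered one-line sub-goal form.
* `stub_pairGoldstoneShapeOnBox_of_boxPgd_of_boxChargingFloor` — hence (GD) on the box and (Ch) on the box give
  VERBATIM the registered (GS-box) signature (box ⊂ `{U > 0} × (0,1/2)`).
* `stub_pairGoldstoneShapeOnBox_of_pgd_of_chargingFloor` — and, a fortiori, so do the unrestricted stmt-1089 stubs
  (GD), (Ch) verbatim (restriction of the `∀ (U,δ)` engine to the box).

Nothing here proves (GD), (Ch), (GS) or the stub (open physics: no reflection positivity off half filling); no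
definition, no named fact. Sources: Kennedy–Lieb–Shastry, PRL 61 (1988) 2582 (ground-state Gaussian domination ⇒
infrared bound: the shape); Pitaevskii–Stringari, J. Low Temp. Phys. 85 (1991) 377 (moment inequality);
Lin–Hirsch–Scalapino, PRB 37 (1988) 7359, eq. (9) (pair chemical potentials, the charging energy `pairGap`).
-/

-- the summit namespace repeats the problem name by design (D-0017)
set_option linter.dupNamespace false

namespace Summit.HubbardSuperconductivity.HubbardSuperconductivity.Theorems.FunctionFieldCertificate

open Matrix Finset
open Literature.Probability.LatticeModels Literature.MathematicalPhysics.QuantumLattice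
open Summit.HubbardSuperconductivity.HubbardSuperconductivity.Theses.FunctionFieldCertificate
open Summit.HubbardSuperconductivity.HubbardSuperconductivity.Theorems.WindowInfraredBound
open scoped ComplexOrder ComplexConjugate

/-- **(GD)-at-a-point ∧ (Ch)-at-a-point ⇒ (GS)-at-a-point.** Fix `U > 0` and `δ ∈ (0,1/2)`, and put
`H = hubbardTorus 2 L 1 U`, `N = N_L = 2⌊(1-δ)L²/2⌋`, `E(M) = H.minEnergyOn (szSector M 0)`,
`Δ = pairFieldAt dWaveFormFactor L m`. IF (GD) holds at `(U,δ)` — there are `C_χ, c₀ ≥ 0`, `η > 0` with, eventually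
in even `L`, for every window momentum `0 < |q_m| ≤ η` and every real `t`,
`E(N) − μ∓N − C_χ(L²/|q_m|²)t² ≤ minEnergyOn (H − μ∓N̂ − t(Δ + Δᴴ)) ((N∓2,0) ⊔ (N,0))`,
`μ₋ = (E(N) − E(N−2) + c₀|q_m|²)/2`, `μ₊ = (E(N+2) − E(N) − c₀|q_m|²)/2` — AND (Ch) holds at `(U,δ)` — some `κ ≥ 0`
with `−κ/L ≤ pairGap H N` eventually in even `L` — THEN (GS) holds at `(U,δ)`: there are `A ≥ 0`, `ε₀ > 0`, `L₀`
with `S_ψ(m)·|q_m| ≤ A` for every even `L ≥ L₀`, every normalised `(N,0)`-sector ground state `ψ` and every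
`0 < |q_m| ≤ ε₀`; explicitly `ε₀ = η`, `A = 2√((C₁ + C₃C₂)C_χ) + 2κC_χ/π + 2c₀C_χη` with the landed budgets
F1 = `stub_doubleCommBound` (at `μ = 0`), F2 = `WcbcsSsbToTorusLRO.stub_pairCommutatorBudget`,
F3 = `wib_twoParticleCost_holds`. Proof = the body of `goldstoneShape_of_pairGaussianDomination_of_chargingFloor`
run at the fixed point: first variation (`stub_pgdFirstVariation`) ⇒ (T_λ∓), then
`goldstoneShape_of_regularisedClosure`. Kennedy–Lieb–Shastry (1988); Pitaevskii–Stringari (1991). [folklore] -/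
theorem goldstoneShapeAt_of_pgdAt_of_chargingFloorAt {U δ : ℝ} (hU : 0 < U) (hδ : δ ∈ Set.Ioo (0:ℝ) (1 / 2))
    (hGD : ∃ C_χ c₀ η : ℝ, 0 ≤ C_χ ∧ 0 ≤ c₀ ∧ 0 < η ∧ ∃ L₀ : ℕ,
      ∀ (L : ℕ) [NeZero L], L₀ ≤ L → Even L → ∀ m : TorusSite 2 L, m ≠ 0 → momentumNormSq L m ≤ η ^ 2 →
        ∀ t : ℝ,
          ((hubbardTorus 2 L 1 U).minEnergyOn (szSector (2 * ⌊(1 - δ) * (L : ℝ) ^ 2 / 2⌋₊) 0) -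
              ((hubbardTorus 2 L 1 U).minEnergyOn (szSector (2 * ⌊(1 - δ) * (L : ℝ) ^ 2 / 2⌋₊) 0) -
                  (hubbardTorus 2 L 1 U).minEnergyOn (szSector (2 * ⌊(1 - δ) * (L : ℝ) ^ 2 / 2⌋₊ - 2) 0) +
                  c₀ * momentumNormSq L m) / 2 * ((2 * ⌊(1 - δ) * (L : ℝ) ^ 2 / 2⌋₊ : ℕ) : ℝ) -
              C_χ * (L : ℝ) ^ 2 / momentumNormSq L m * t ^ 2 ≤
            (hubbardTorus 2 L 1 U -
              ((((hubbardTorus 2 L 1 U).minEnergyOn (szSector (2 * ⌊(1 - δ) * (L : ℝ) ^ 2 / 2⌋₊) 0) -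
                  (hubbardTorus 2 L 1 U).minEnergyOn (szSector (2 * ⌊(1 - δ) * (L : ℝ) ^ 2 / 2⌋₊ - 2) 0) +
                  c₀ * momentumNormSq L m) / 2 : ℝ) : ℂ) •
                (totalNumber : Matrix (Finset (Orb (FermionTorus 2 L))) (Finset (Orb (FermionTorus 2 L))) ℂ) -
              (t : ℂ) • (pairFieldAt dWaveFormFactor L m + (pairFieldAt dWaveFormFactor L m)ᴴ)).minEnergyOn
              (szSector (2 * ⌊(1 - δ) * (L : ℝ) ^ 2 / 2⌋₊ - 2) 0 ⊔
                szSector (2 * ⌊(1 - δ) * (L : ℝ) ^ 2 / 2⌋₊) 0)) ∧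
          ((hubbardTorus 2 L 1 U).minEnergyOn (szSector (2 * ⌊(1 - δ) * (L : ℝ) ^ 2 / 2⌋₊) 0) -
              ((hubbardTorus 2 L 1 U).minEnergyOn (szSector (2 * ⌊(1 - δ) * (L : ℝ) ^ 2 / 2⌋₊ + 2) 0) -
                  (hubbardTorus 2 L 1 U).minEnergyOn (szSector (2 * ⌊(1 - δ) * (L : ℝ) ^ 2 / 2⌋₊) 0) -
                  c₀ * momentumNormSq L m) / 2 * ((2 * ⌊(1 - δ) * (L : ℝ) ^ 2 / 2⌋₊ : ℕ) : ℝ) -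
              C_χ * (L : ℝ) ^ 2 / momentumNormSq L m * t ^ 2 ≤
            (hubbardTorus 2 L 1 U -
              ((((hubbardTorus 2 L 1 U).minEnergyOn (szSector (2 * ⌊(1 - δ) * (L : ℝ) ^ 2 / 2⌋₊ + 2) 0) -
                  (hubbardTorus 2 L 1 U).minEnergyOn (szSector (2 * ⌊(1 - δ) * (L : ℝ) ^ 2 / 2⌋₊) 0) -
                  c₀ * momentumNormSq L m) / 2 : ℝ) : ℂ) •
                (totalNumber : Matrix (Finset (Orb (FermionTorus 2 L))) (Finset (Orb (FermionTorus 2 L))) ℂ) -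
              (t : ℂ) • (pairFieldAt dWaveFormFactor L m + (pairFieldAt dWaveFormFactor L m)ᴴ)).minEnergyOn
              (szSector (2 * ⌊(1 - δ) * (L : ℝ) ^ 2 / 2⌋₊) 0 ⊔
                szSector (2 * ⌊(1 - δ) * (L : ℝ) ^ 2 / 2⌋₊ + 2) 0)))
    (hCh : ∃ κ : ℝ, 0 ≤ κ ∧ ∃ L₀ : ℕ, ∀ (L : ℕ) [NeZero L],
      L₀ ≤ L → Even L → -(κ / (L : ℝ)) ≤ pairGap (hubbardTorus 2 L 1 U) (2 * ⌊(1 - δ) * (L : ℝ) ^ 2 / 2⌋₊)) :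
    ∃ A ε₀ : ℝ, 0 ≤ A ∧ 0 < ε₀ ∧ ∃ L₀ : ℕ,
      ∀ (L : ℕ) [NeZero L], L₀ ≤ L → Even L → ∀ ψ : Fock (Orb (FermionTorus 2 L)),
        star ψ ⬝ᵥ ψ = 1 →
          IsGroundStateInSector (hubbardTorus 2 L 1 U) (2 * ⌊(1 - δ) * (L : ℝ) ^ 2 / 2⌋₊) 0 ψ →
            ∀ m : TorusSite 2 L, m ≠ 0 → momentumNormSq L m ≤ ε₀ ^ 2 →
              pairStructureFactor dWaveFormFactor L ψ m * Real.sqrt (momentumNormSq L m) ≤ A := by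
  obtain ⟨C_X, c₀, η, hCX, hc₀, hη, L₁, hGD⟩ := hGD
  obtain ⟨κ, hκ, L₂, hCh⟩ := hCh
  obtain ⟨C₃, hC₃, L₃, hF3⟩ := wib_twoParticleCost_holds U hU δ hδ
  obtain ⟨C, hC, hB⟩ := stub_doubleCommBound U hU
  obtain ⟨B, hB0, hPCB⟩ := WcbcsSsbToTorusLRO.stub_pairCommutatorBudget
  refine ⟨2 * Real.sqrt ((C + C₃ * B) * C_X) + 2 * κ * C_X / Real.pi + 2 * c₀ * C_X * η, η,
    by positivity, hη, max (max L₁ L₂) (max L₃ 2), fun L _ hL₀ hev ψ hψ1 hψ m hm0 hmη => ?_⟩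
  have hL₁ : L₁ ≤ L := le_trans (le_max_left _ _) ((le_max_left _ _).trans hL₀)
  have hL₂ : L₂ ≤ L := le_trans (le_max_right _ _) ((le_max_left _ _).trans hL₀)
  have hL₃ : L₃ ≤ L := le_trans (le_max_left _ _) ((le_max_right _ _).trans hL₀)
  have hL2 : 2 ≤ L := le_trans (le_max_right _ _) ((le_max_right _ _).trans hL₀)
  have hN : 2 ≤ 2 * ⌊(1 - δ) * (L : ℝ) ^ 2 / 2⌋₊ := wib_two_le_summitFilling hδ hL2
  -- (GD) at this `L`, `m`, all `t`; the landed first variation (p96685) ⇒ (T_λ∓)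
  have hGD' := hGD L hL₁ hev m hm0 hmη
  obtain ⟨hTm, hTp⟩ := stub_pgdFirstVariation L U (2 * ⌊(1 - δ) * (L : ℝ) ^ 2 / 2⌋₊) hN ψ hψ hψ1 m
    (C_X * (L : ℝ) ^ 2 / momentumNormSq L m) (c₀ * momentumNormSq L m)
  have hTm' := hTm (fun t => (hGD' t).1)
  have hTp' := hTp (fun t => (hGD' t).2)
  -- (F1) at `μ = 0`
  have hF1 : (star ψ ⬝ᵥ (((pairFieldAt dWaveFormFactor L m)ᴴ *
        (hubbardTorus 2 L 1 U * pairFieldAt dWaveFormFactor L m -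
          pairFieldAt dWaveFormFactor L m * hubbardTorus 2 L 1 U) -
        (hubbardTorus 2 L 1 U * pairFieldAt dWaveFormFactor L m -
          pairFieldAt dWaveFormFactor L m * hubbardTorus 2 L 1 U) *
        (pairFieldAt dWaveFormFactor L m)ᴴ) *ᵥ ψ)).re ≤ C * (L : ℝ) ^ 2 := by
    have h := hB L 0 m ψ
    rw [hubbardTorusWith_zero, hψ1, Complex.one_re, mul_one, abs_zero, add_zero, mul_one] at h
    exact (le_abs_self _).trans h
  -- (F2)
  have hF2 : |(star ψ ⬝ᵥ (((pairFieldAt dWaveFormFactor L m)ᴴ * pairFieldAt dWaveFormFactor L m -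
        pairFieldAt dWaveFormFactor L m * (pairFieldAt dWaveFormFactor L m)ᴴ) *ᵥ ψ)).re| ≤
        B * (L : ℝ) ^ 2 := by
    have h := hPCB L m ψ
    rwa [hψ1, Complex.one_re, mul_one] at h
  -- (F3) and (Ch) at this `L`; the one-state regularised closure
  exact goldstoneShape_of_regularisedClosure hN hψ hψ1 hm0 hCX hC hB0 hC₃ hκ hc₀ hmη hη
    hTm' hTp' hF1 hF2 (hF3 L hL₃ hev) (hCh L hL₂ hev)

/-- Registered sub-goal form of `goldstoneShapeAt_of_pgdAt_of_chargingFloorAt` (item stmt-HubbardSuperconductivity-7331,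
line `redirect_birth`, stub (GS-box), lead c11 wave 3): at one point `U > 0`, `δ ∈ (0,1/2)`, (GD)-body → (Ch)-body →
(GS)-body. [folklore] -/
theorem goldstoneShapeAtOfPgdAtOfChargingFloorAt : ∀ U δ : ℝ, 0 < U → δ ∈ Set.Ioo (0:ℝ) (1 / 2) → (∃ C_χ c₀ η : ℝ, 0 ≤ C_χ ∧ 0 ≤ c₀ ∧ 0 < η ∧ ∃ L₀ : ℕ, ∀ (L : ℕ) [NeZero L], L₀ ≤ L → Even L → ∀ m : TorusSite 2 L, m ≠ 0 → momentumNormSq L m ≤ η ^ 2 → ∀ t : ℝ, ((hubbardTorus 2 L 1 U).minEnergyOn (szSector (2 * ⌊(1 - δ) * (L : ℝ) ^ 2 / 2⌋₊) 0) - ((hubbardTorus 2 L 1 U).minEnergyOn (szSector (2 * ⌊(1 - δ) * (L : ℝ) ^ 2 / 2⌋₊) 0) - (hubbardTorus 2 L 1 U).minEnergyOn (szSector (2 * ⌊(1 - δ) * (L : ℝ) ^ 2 / 2⌋₊ - 2) 0) + c₀ * momentumNormSq L m) / 2 * ((2 * ⌊(1 - δ) * (L : ℝ) ^ 2 / 2⌋₊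 : ℕ) : ℝ) - C_χ * (L : ℝ) ^ 2 / momentumNormSq L m * t ^ 2 ≤ (hubbardTorus 2 L 1 U - ((((hubbardTorus 2 L 1 U).minEnergyOn (szSector (2 * ⌊(1 - δ) * (L : ℝ) ^ 2 / 2⌋₊) 0) - (hubbardTorus 2 L 1 U).minEnergyOn (szSector (2 * ⌊(1 - δ) * (L : ℝ) ^ 2 / 2⌋₊ - 2) 0) + c₀ * momentumNormSq L m) / 2 : ℝ) : ℂ) • (totalNumber : Matrix (Finset (Orb (FermionTorus 2 L))) (Finset (Orb (FermionTorus 2 L))) ℂ) - (t : ℂ) • (pairFieldAt dWaveFormFactor L m + (pairFieldAt dWaveFormFactor L m)ᴴ)).minEnergyOn (szSector (2 * ⌊(1 - δ) * (L : ℝ) ^ 2 / 2⌋₊ - 2) 0 ⊔ szSector (2 * ⌊(1 - δ) * (L : ℝ) ^ 2 / 2⌋₊) 0)) ∧ ((hubbardTorus 2 L 1 U).minEnergyOn (szSector (2 * ⌊(1 - δ) * (L : ℝ) ^ 2 / 2⌋₊) 0) - ((hubbardTorus 2 L 1 U).minEnergyOn (szSector (2 * ⌊(1 - δ) * (L : ℝ)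 ^ 2 / 2⌋₊ + 2) 0) - (hubbardTorus 2 L 1 U).minEnergyOn (szSector (2 * ⌊(1 - δ) * (L : ℝ) ^ 2 / 2⌋₊) 0) - c₀ * momentumNormSq L m) / 2 * ((2 * ⌊(1 - δ) * (L : ℝ) ^ 2 / 2⌋₊ : ℕ) : ℝ) - C_χ * (L : ℝ) ^ 2 / momentumNormSq L m * t ^ 2 ≤ (hubbardTorus 2 L 1 U - ((((hubbardTorus 2 L 1 U).minEnergyOn (szSector (2 * ⌊(1 - δ) * (L : ℝ) ^ 2 / 2⌋₊ + 2) 0) - (hubbardTorus 2 L 1 U).minEnergyOn (szSector (2 * ⌊(1 - δ) * (L : ℝ) ^ 2 / 2⌋₊) 0) - c₀ * momentumNormSq L m) / 2 : ℝ) : ℂ) • (totalNumber : Matrix (Finset (Orb (FermionTorus 2 L))) (Finset (Orb (FermionTorus 2 L))) ℂ) - (t : ℂ) • (pairFieldAt dWaveFormFactor L m + (pairFieldAt dWaveFormFactor L m)ᴴ)).minEnergyOn (szSector (2 * ⌊(1 - δ) * (L : ℝ) ^ 2 / 2⌋₊) 0 ⊔ szSector (2 * ⌊(1 - δ) * (L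 : ℝ) ^ 2 / 2⌋₊ + 2) 0))) → (∃ κ : ℝ, 0 ≤ κ ∧ ∃ L₀ : ℕ, ∀ (L : ℕ) [NeZero L], L₀ ≤ L → Even L → -(κ / (L : ℝ)) ≤ pairGap (hubbardTorus 2 L 1 U) (2 * ⌊(1 - δ) * (L : ℝ) ^ 2 / 2⌋₊)) → ∃ A ε₀ : ℝ, 0 ≤ A ∧ 0 < ε₀ ∧ ∃ L₀ : ℕ, ∀ (L : ℕ) [NeZero L], L₀ ≤ L → Even L → ∀ ψ : Fock (Orb (FermionTorus 2 L)), star ψ ⬝ᵥ ψ = 1 → IsGroundStateInSector (hubbardTorus 2 L 1 U) (2 * ⌊(1 - δ) * (L : ℝ) ^ 2 / 2⌋₊) 0 ψ → ∀ m : TorusSite 2 L, m ≠ 0 → momentumNormSq L m ≤ ε₀ ^ 2 → pairStructureFactor dWaveFormFactor L ψ m * Real.sqrt (momentumNormSq L m) ≤ A :=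
  fun _ _ hU hδ hGD hCh => goldstoneShapeAt_of_pgdAt_of_chargingFloorAt hU hδ hGD hCh

/-- **Box-restricted (GD) ∧ box-restricted (Ch) ⇒ the registered stub (GS-box), verbatim.** If the body of
(GD) = C⁺_λ and the body of (Ch) hold at every `(U, δ)` of the box `U ∈ (0,6]`, `δ ∈ [1/10,3/10]` (eventually in
even `L`, constants depending on the point), then `stub_pairGoldstoneShapeOnBox` holds: the box lies in
`{U > 0} × (0,1/2)`, apply `goldstoneShapeAt_of_pgdAt_of_chargingFloorAt` pointwise. This is the composition by which
box-restricted promotions of the two stmt-1089 physics inputs feed line `redirect_birth`. [folklore] -/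
theorem stub_pairGoldstoneShapeOnBox_of_boxPgd_of_boxChargingFloor
    (hGD : ∀ U : ℝ, U ∈ Set.Ioc (0:ℝ) 6 → ∀ δ : ℝ, δ ∈ Set.Icc (1 / 10 : ℝ) (3 / 10) →
      ∃ C_χ c₀ η : ℝ, 0 ≤ C_χ ∧ 0 ≤ c₀ ∧ 0 < η ∧ ∃ L₀ : ℕ,
      ∀ (L : ℕ) [NeZero L], L₀ ≤ L → Even L → ∀ m : TorusSite 2 L, m ≠ 0 → momentumNormSq L m ≤ η ^ 2 →
        ∀ t : ℝ,
          ((hubbardTorus 2 L 1 U).minEnergyOn (szSector (2 * ⌊(1 - δ) * (L : ℝ) ^ 2 / 2⌋₊) 0) -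
              ((hubbardTorus 2 L 1 U).minEnergyOn (szSector (2 * ⌊(1 - δ) * (L : ℝ) ^ 2 / 2⌋₊) 0) -
                  (hubbardTorus 2 L 1 U).minEnergyOn (szSector (2 * ⌊(1 - δ) * (L : ℝ) ^ 2 / 2⌋₊ - 2) 0) +
                  c₀ * momentumNormSq L m) / 2 * ((2 * ⌊(1 - δ) * (L : ℝ) ^ 2 / 2⌋₊ : ℕ) : ℝ) -
              C_χ * (L : ℝ) ^ 2 / momentumNormSq L m * t ^ 2 ≤
            (hubbardTorus 2 L 1 U -
              ((((hubbardTorus 2 L 1 U).minEnergyOn (szSector (2 * ⌊(1 - δ) * (L : ℝ) ^ 2 / 2⌋₊) 0) -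
                  (hubbardTorus 2 L 1 U).minEnergyOn (szSector (2 * ⌊(1 - δ) * (L : ℝ) ^ 2 / 2⌋₊ - 2) 0) +
                  c₀ * momentumNormSq L m) / 2 : ℝ) : ℂ) •
                (totalNumber : Matrix (Finset (Orb (FermionTorus 2 L))) (Finset (Orb (FermionTorus 2 L))) ℂ) -
              (t : ℂ) • (pairFieldAt dWaveFormFactor L m + (pairFieldAt dWaveFormFactor L m)ᴴ)).minEnergyOn
              (szSector (2 * ⌊(1 - δ) * (L : ℝ) ^ 2 / 2⌋₊ - 2) 0 ⊔
                szSector (2 * ⌊(1 - δ) * (L : ℝ) ^ 2 / 2⌋₊) 0)) ∧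
          ((hubbardTorus 2 L 1 U).minEnergyOn (szSector (2 * ⌊(1 - δ) * (L : ℝ) ^ 2 / 2⌋₊) 0) -
              ((hubbardTorus 2 L 1 U).minEnergyOn (szSector (2 * ⌊(1 - δ) * (L : ℝ) ^ 2 / 2⌋₊ + 2) 0) -
                  (hubbardTorus 2 L 1 U).minEnergyOn (szSector (2 * ⌊(1 - δ) * (L : ℝ) ^ 2 / 2⌋₊) 0) -
                  c₀ * momentumNormSq L m) / 2 * ((2 * ⌊(1 - δ) * (L : ℝ) ^ 2 / 2⌋₊ : ℕ) : ℝ) -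
              C_χ * (L : ℝ) ^ 2 / momentumNormSq L m * t ^ 2 ≤
            (hubbardTorus 2 L 1 U -
              ((((hubbardTorus 2 L 1 U).minEnergyOn (szSector (2 * ⌊(1 - δ) * (L : ℝ) ^ 2 / 2⌋₊ + 2) 0) -
                  (hubbardTorus 2 L 1 U).minEnergyOn (szSector (2 * ⌊(1 - δ) * (L : ℝ) ^ 2 / 2⌋₊) 0) -
                  c₀ * momentumNormSq L m) / 2 : ℝ) : ℂ) •
                (totalNumber : Matrix (Finset (Orb (FermionTorus 2 L))) (Finset (Orb (FermionTorus 2 L))) ℂ) -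
              (t : ℂ) • (pairFieldAt dWaveFormFactor L m + (pairFieldAt dWaveFormFactor L m)ᴴ)).minEnergyOn
              (szSector (2 * ⌊(1 - δ) * (L : ℝ) ^ 2 / 2⌋₊) 0 ⊔
                szSector (2 * ⌊(1 - δ) * (L : ℝ) ^ 2 / 2⌋₊ + 2) 0)))
    (hCh : ∀ U : ℝ, U ∈ Set.Ioc (0:ℝ) 6 → ∀ δ : ℝ, δ ∈ Set.Icc (1 / 10 : ℝ) (3 / 10) →
      ∃ κ : ℝ, 0 ≤ κ ∧ ∃ L₀ : ℕ, ∀ (L : ℕ) [NeZero L],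
      L₀ ≤ L → Even L → -(κ / (L : ℝ)) ≤ pairGap (hubbardTorus 2 L 1 U) (2 * ⌊(1 - δ) * (L : ℝ) ^ 2 / 2⌋₊)) :
    ∀ U : ℝ, U ∈ Set.Ioc (0:ℝ) 6 → ∀ δ : ℝ, δ ∈ Set.Icc (1 / 10 : ℝ) (3 / 10) →
      ∃ A ε₀ : ℝ, 0 ≤ A ∧ 0 < ε₀ ∧ ∃ L₀ : ℕ,
      ∀ (L : ℕ) [NeZero L], L₀ ≤ L → Even L →
        ∀ ψ : Fock (Orb (FermionTorus 2 L)), star ψ ⬝ᵥ ψ = 1 →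
          IsGroundStateInSector (hubbardTorus 2 L 1 U) (2 * ⌊(1 - δ) * (L : ℝ) ^ 2 / 2⌋₊) 0 ψ →
            ∀ m : TorusSite 2 L, m ≠ 0 → momentumNormSq L m ≤ ε₀ ^ 2 →
              pairStructureFactor dWaveFormFactor L ψ m * Real.sqrt (momentumNormSq L m) ≤ A := by
  intro U hU δ hδ
  have hδ' : δ ∈ Set.Ioo (0:ℝ) (1 / 2) := ⟨by linarith [hδ.1], by linarith [hδ.2]⟩
  exact goldstoneShapeAt_of_pgdAt_of_chargingFloorAt hU.1 hδ' (hGD U hU δ hδ) (hCh U hU δ hδ)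

/-- **The unrestricted stmt-1089 stubs still deliver (GS-box).** (GD) = `WindowInfraredBound.stub_pairGaussianDomination`
verbatim and (Ch) = `WindowInfraredBound.stub_chargingFloor` verbatim (both at ALL `U > 0`, `δ ∈ (0,1/2)`) imply
`stub_pairGoldstoneShapeOnBox`: restrict the `∀ (U,δ)` engine `goldstoneShape_of_pairGaussianDomination_of_chargingFloor`
to the box (equivalently, `stub_pairGoldstoneShapeOnBox_of_boxPgd_of_boxChargingFloor` on the restricted inputs). [folklore] -/
theorem stub_pairGoldstoneShapeOnBox_of_pgd_of_chargingFloor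
    (hGD : ∀ U : ℝ, 0 < U → ∀ δ ∈ Set.Ioo (0:ℝ) (1 / 2), ∃ C_χ c₀ η : ℝ, 0 ≤ C_χ ∧ 0 ≤ c₀ ∧ 0 < η ∧ ∃ L₀ : ℕ,
      ∀ (L : ℕ) [NeZero L], L₀ ≤ L → Even L → ∀ m : TorusSite 2 L, m ≠ 0 → momentumNormSq L m ≤ η ^ 2 →
        ∀ t : ℝ,
          ((hubbardTorus 2 L 1 U).minEnergyOn (szSector (2 * ⌊(1 - δ) * (L : ℝ) ^ 2 / 2⌋₊) 0) -
              ((hubbardTorus 2 L 1 U).minEnergyOn (szSector (2 * ⌊(1 - δ) * (L : ℝ) ^ 2 / 2⌋₊) 0) -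
                  (hubbardTorus 2 L 1 U).minEnergyOn (szSector (2 * ⌊(1 - δ) * (L : ℝ) ^ 2 / 2⌋₊ - 2) 0) +
                  c₀ * momentumNormSq L m) / 2 * ((2 * ⌊(1 - δ) * (L : ℝ) ^ 2 / 2⌋₊ : ℕ) : ℝ) -
              C_χ * (L : ℝ) ^ 2 / momentumNormSq L m * t ^ 2 ≤
            (hubbardTorus 2 L 1 U -
              ((((hubbardTorus 2 L 1 U).minEnergyOn (szSector (2 * ⌊(1 - δ) * (L : ℝ) ^ 2 / 2⌋₊) 0) -
                  (hubbardTorus 2 L 1 U).minEnergyOn (szSector (2 * ⌊(1 - δ) * (L : ℝ) ^ 2 / 2⌋₊ - 2) 0) +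
                  c₀ * momentumNormSq L m) / 2 : ℝ) : ℂ) •
                (totalNumber : Matrix (Finset (Orb (FermionTorus 2 L))) (Finset (Orb (FermionTorus 2 L))) ℂ) -
              (t : ℂ) • (pairFieldAt dWaveFormFactor L m + (pairFieldAt dWaveFormFactor L m)ᴴ)).minEnergyOn
              (szSector (2 * ⌊(1 - δ) * (L : ℝ) ^ 2 / 2⌋₊ - 2) 0 ⊔
                szSector (2 * ⌊(1 - δ) * (L : ℝ) ^ 2 / 2⌋₊) 0)) ∧
          ((hubbardTorus 2 L 1 U).minEnergyOn (szSector (2 * ⌊(1 - δ) * (L : ℝ) ^ 2 / 2⌋₊) 0) -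
              ((hubbardTorus 2 L 1 U).minEnergyOn (szSector (2 * ⌊(1 - δ) * (L : ℝ) ^ 2 / 2⌋₊ + 2) 0) -
                  (hubbardTorus 2 L 1 U).minEnergyOn (szSector (2 * ⌊(1 - δ) * (L : ℝ) ^ 2 / 2⌋₊) 0) -
                  c₀ * momentumNormSq L m) / 2 * ((2 * ⌊(1 - δ) * (L : ℝ) ^ 2 / 2⌋₊ : ℕ) : ℝ) -
              C_χ * (L : ℝ) ^ 2 / momentumNormSq L m * t ^ 2 ≤
            (hubbardTorus 2 L 1 U -
              ((((hubbardTorus 2 L 1 U).minEnergyOn (szSector (2 * ⌊(1 - δ) * (L : ℝ) ^ 2 / 2⌋₊ + 2) 0) -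
                  (hubbardTorus 2 L 1 U).minEnergyOn (szSector (2 * ⌊(1 - δ) * (L : ℝ) ^ 2 / 2⌋₊) 0) -
                  c₀ * momentumNormSq L m) / 2 : ℝ) : ℂ) •
                (totalNumber : Matrix (Finset (Orb (FermionTorus 2 L))) (Finset (Orb (FermionTorus 2 L))) ℂ) -
              (t : ℂ) • (pairFieldAt dWaveFormFactor L m + (pairFieldAt dWaveFormFactor L m)ᴴ)).minEnergyOn
              (szSector (2 * ⌊(1 - δ) * (L : ℝ) ^ 2 / 2⌋₊) 0 ⊔
                szSector (2 * ⌊(1 - δ) * (L : ℝ) ^ 2 / 2⌋₊ + 2) 0)))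
    (hCh : ∀ U : ℝ, 0 < U → ∀ δ ∈ Set.Ioo (0:ℝ) (1 / 2), ∃ κ : ℝ, 0 ≤ κ ∧ ∃ L₀ : ℕ, ∀ (L : ℕ) [NeZero L],
      L₀ ≤ L → Even L → -(κ / (L : ℝ)) ≤ pairGap (hubbardTorus 2 L 1 U) (2 * ⌊(1 - δ) * (L : ℝ) ^ 2 / 2⌋₊)) :
    ∀ U : ℝ, U ∈ Set.Ioc (0:ℝ) 6 → ∀ δ : ℝ, δ ∈ Set.Icc (1 / 10 : ℝ) (3 / 10) →
      ∃ A ε₀ : ℝ, 0 ≤ A ∧ 0 < ε₀ ∧ ∃ L₀ : ℕ,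
      ∀ (L : ℕ) [NeZero L], L₀ ≤ L → Even L →
        ∀ ψ : Fock (Orb (FermionTorus 2 L)), star ψ ⬝ᵥ ψ = 1 →
          IsGroundStateInSector (hubbardTorus 2 L 1 U) (2 * ⌊(1 - δ) * (L : ℝ) ^ 2 / 2⌋₊) 0 ψ →
            ∀ m : TorusSite 2 L, m ≠ 0 → momentumNormSq L m ≤ ε₀ ^ 2 →
              pairStructureFactor dWaveFormFactor L ψ m * Real.sqrt (momentumNormSq L m) ≤ A :=
  fun U hU δ hδ => goldstoneShape_of_pairGaussianDomination_of_chargingFloor hGD hCh U hU.1 δ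
    ⟨by linarith [hδ.1], by linarith [hδ.2]⟩

end Summit.HubbardSuperconductivity.HubbardSuperconductivity.Theorems.FunctionFieldCertificate
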